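import Summits.CriticalPhenomena.Ising3DConformalLimit.Theses.OctantEntropy
import Literature.Probability.LatticeModels.CriticalTwoPointBounds
import Literature.Probability.LatticeModels.TwoPointSupNormMonotone
import HarnessLib.Audit.Check

/-!
# Birth skeleton for crux `FirstMomentBoxSum` (stmt-CriticalPhenomena-11354), route `OctantEntropy`

Crux (F), rank 4 of `route-CriticalPhenomena-OctantEntropy` (sub-problem `Ising3DConformalLimit`):
`(b_K − log₂ S_K) / K → 0`, where
* `b_K = limsup_L log₂ E_{K,L}[mass_K]` is the annealed log-mass of the dyadic window
  `W_K = [−2^K, 2^K)³` under the critical SOURCED double current `P_{K,L}` of the free box graph of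
  `Λ_L ⊂ ℤ³` (sources `0` and `y_K = 2^(K+1) e₁` for `n₁`, none for `n₂`), `mass_K = #(C_{n₁+n₂}(0) ∩ W_K)`;
* `S_K = Σ_{u ∈ W_K} G(u)`, `G = ⟨σ₀σ_·⟩⁺_{β_c(3)} = criticalTwoPoint 3`.

## The line (the route's own two-layer plan "F ⇐ ThermodynamicLimitOfWeights → TemperedDoubling → F",
## made into three registered stubs and a kernel-checked composition)

Write `T_K := Σ_{u ∈ W_K} G(u) G(y_K − u) / G(y_K)` (the SWITCHED first moment in infinite volume),
`x_K := ⌊2^K/3⌋ e₁` (near comparison point) and `z_K := 9·2^K e₁` (far comparison point).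

* `stub_firstMomentLimit` (M, PROVABLE NOW — Gibbs-state bookkeeping): for every `K`,
  `E_{K,L}[mass_K] → T_K` as `L → ∞`.  Route: the PROVED item `SwitchingFirstMoment`
  (`Theorems/OctantEntropySwitchingFirstMoment.lean`, `integral_card_filter_tracedConn_eq_sum`) gives, for
  `2^(K+1) ≤ L`, `E_{K,L}[mass_K] = Σ_{u ∈ W_K} ⟨σ₀σ_u⟩_L ⟨σ_uσ_y⟩_L / ⟨σ₀σ_y⟩_L` with the free two-point
  functions of the free box graph; `isingTwoPoint_free_box_eq_boxGraph` reads them as the free state of the box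
  `Λ_L ⊂ ℤ³`; `hasBoxLimit_isingCorr_free` (GKS, `L → ∞`) + translation invariance of the free state +
  `twoPointPlus_criticalBeta_eq_twoPointFree_holds` (continuity at `β_c(3)`, ADS15) identify the limit of each
  summand as `G(u) G(y_K − u) / G(y_K)` (`G(y_K) > 0`, Simon–Lieb).
* `stub_farSourceSandwich` (S–M, PROVABLE NOW — Messager–Miracle-Solé geometry):
  `T_K · G(z_K) ≤ S_K · G(x_K)` and `S_K · G(z_K) ≤ T_K · G(x_K)`.  For `u ∈ W_K`,
  `‖y_K − u‖_∞ ∈ [2^K + 1, 3·2^K]` and `‖y_K‖_∞ = 2^(K+1)`, so the sup-norm MMS comparison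
  `3‖a‖_∞ ≤ ‖b‖_∞ ⇒ G(b) ≤ G(a)` (`twoPointPlus_le_of_mul_supNorm_le`, ADC21 eq. (5.3), PROVED) gives
  `G(z_K) ≤ G(y_K − u) ≤ G(x_K)` and `G(z_K) ≤ G(y_K) ≤ G(x_K)` (`3⌊2^K/3⌋ ≤ 2^K`, `9·2^K ≥ 3·3·2^K`), whence
  `G(z_K)/G(x_K) ≤ G(y_K − u)/G(y_K) ≤ G(x_K)/G(z_K)` term by term (all terms `> 0`).
* `stub_temperedDoubling` (L, OPEN — THE LOAD-BEARING STUB, the route's `TemperedDoubling`):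
  `(log₂ G(x_K) − log₂ G(z_K)) / K → 0`: the critical two-point function loses only `2^(o(K))` across the
  fixed-ratio window `[2^K/3, 9·2^K]` on the axis.  Necessary for the route (η exists ⇒ it); implied by the
  all-scale axis doubling item `MirrorHoelderCompactness.TwoPointDoubling` (stmt-CriticalPhenomena-6150) with
  axis monotonicity (`criticalTwoPoint_axis_succ_le`): `g(9·2^K) ≥ g(2^(K+4)) ≥ κ⁶ g(2^(K−2)) ≥ κ⁶ g(⌊2^K/3⌋)`.
  Why it might fail (refuter rattack-11354, grounder g13-38/g20-27): a completely monotone "staircase"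
  `G(t e₁) = Σ_m A_m e^(−a_m t)/t` is compatible with every in-tree two-point fact (MMS, log-convexity
  `criticalTwoPoint_axis_ratio_mono`, `c‖x‖⁻² ≤ G ≤ C‖x‖⁻¹`, the DCP25 gradient estimate) yet has
  `G(x_K)/G(z_K) = 2^(Θ(K))` along a subsequence; ADC21 Thm 5.12 gives regularity at a positive density of
  scales only.
* `FirstMomentBoxSum_of` (REAL PROOF, this file): `b_K = log₂ T_K` (`Tendsto.limsup_eq`, continuity of `log`
  at `T_K > 0`, positivity of `T_K` from the sandwich and `S_K ≥ G(0) = 1`), then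
  `|log₂ T_K − log₂ S_K| ≤ log₂ G(x_K) − log₂ G(z_K)` (monotonicity of `log₂` on the two sandwich
  inequalities) and the squeeze `squeeze_zero_norm` with `stub_temperedDoubling`.

All three stubs are stated over IMPORTABLE vocabulary only (fully qualified, the integrand copied verbatim from
the route decl), so a stub proof lands under `Theorems/` with the registered signature copied word for word.
`Statement.stub_…` are NAMES (`type_of%`) of the three statements, used as the hypotheses of
`FirstMomentBoxSum_of` (layer-invariant audit: hypotheses = declared stubs by name).  The local names
`firstMoment`, `windowSum`, `switchedSum`, `nearVal`, `farVal` are verbatim sub-terms, certified against the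
route decl and the stubs by `Iff.rfl` (`crux_iff`, `stub_…_iff`).

Disproof used: none on file (`ledger crux ls stmt-CriticalPhenomena-11354`: no `Disproof.lean` yet).
Negatives index: no refuted statement of CriticalPhenomena concerns window sums / axis doubling of
`criticalTwoPoint 3` at tempered (sub-exponential-in-`K`) precision; `TwoPointDoubling` (6150, uniform) is OPEN,
not refuted, and is stronger than `stub_temperedDoubling`.
-/

noncomputable section

namespace Summit.CriticalPhenomena.Ising3DConformalLimit.Cruxes.FirstMomentBoxSum.Birth

open scoped BigOperators Topology Classical MeasureTheory ProbabilityTheory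
open Filter Set Function TopologicalSpace MeasureTheory
open Literature.Probability.LatticeModels

/-! ## The three registered stubs -/

/-- **STUB 1 · `stub_firstMomentLimit` (M, provable now) — thermodynamic limit of the switched first moment.**
For every `K`, the `P_{K,L}`-expectation of `mass_K = #(C_{n₁+n₂}(0) ∩ W_K)` (the integrand of the route
decl, verbatim) converges as `L → ∞` to `T_K = Σ_{u ∈ W_K} G(u) G(y_K − u) / G(y_K)`,
`G = criticalTwoPoint 3`, `y_K = 2^(K+1) e₁`.  Tools: `SwitchingFirstMoment` (item 11355, PROVED:
`Theorems.switchingFirstMoment_proof` / `integral_card_filter_tracedConn_eq_sum`) for `2^(K+1) ≤ L`;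
`isingTwoPoint_free_box_eq_boxGraph`; `hasBoxLimit_isingCorr_free`; translation invariance of the free
state; `twoPointPlus_criticalBeta_eq_twoPointFree_holds`; `G > 0`.  (For small `L` the source set degenerates
and the measure is the junk `0`; irrelevant for the limit.) [AizenmanCMP1982 §3; ADC21 Prop. A.3;
AizenmanDuminilCopinSidoraviciusCMP2015 Thm 1.1; FriedliVelenik2017 Exercise 3.16] -/
theorem stub_firstMomentLimit :
    ∀ K : ℕ, Filter.Tendsto (fun L : ℕ => ∫ p, ((Finset.univ.filter fun u : ↥(Literature.Probability.LatticeModels.box 3 (L + 1)) => (∀ i, -(2 ^ K : ℤ) ≤ (u : Literature.Probability.LatticeModels.Site 3) i ∧ (u : Literature.Probability.LatticeModels.Site 3) i < 2 ^ K) ∧ p ∈ Literature.Probability.LatticeModels.tracedConn ((SimpleGraph.mk (fun a b : ↥(Literature.Probability.LatticeModels.box 3 (L + 1)) => (Literature.Probability.LatticeModels.zdGraph 3).Adj a.1 b.1 ∧ (a : Literature.Probability.LatticeModels.Site 3) ∈ Literature.Probability.LatticeModels.box 3 L ∧ (b : Literature.Probability.LatticeModels.Site 3) ∈ Literature.Probability.LatticeModels.box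 3 L) ⟨fun _ _ h => ⟨h.1.symm, h.2.2, h.2.1⟩⟩ ⟨fun _ h => h.1.ne rfl⟩)) ⟨0, Literature.Probability.LatticeModels.zero_mem_box 3 (L + 1)⟩ u).card : ℝ) ∂(Literature.Probability.LatticeModels.doubleCurrentMeasure ((SimpleGraph.mk (fun a b : ↥(Literature.Probability.LatticeModels.box 3 (L + 1)) => (Literature.Probability.LatticeModels.zdGraph 3).Adj a.1 b.1 ∧ (a : Literature.Probability.LatticeModels.Site 3) ∈ Literature.Probability.LatticeModels.box 3 L ∧ (b : Literature.Probability.LatticeModels.Site 3) ∈ Literature.Probability.LatticeModels.box 3 L) ⟨fun _ _ h => ⟨h.1.symm, h.2.2, h.2.1⟩⟩ ⟨fun _ h => h.1.ne rfl⟩)) (Literature.Probability.LatticeModels.criticalBeta 3) (Finset.univ.filter fun v : ↥(Literature.Probability.LatticeModels.box 3 (L + 1)) => (v : Literature.Probability.LatticeModels.Site 3) = 0 ∨ (v : Literature.Probability.LatticeModels.Site 3) = Pi.single 0 (2 ^ (K + 1))) ∅)) Filter.atTop (nhds (∑ u ∈ (Literature.Probability.LatticeModels.box 3 (2 ^ K)).filter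 (fun u : Literature.Probability.LatticeModels.Site 3 => ∀ i, u i < 2 ^ K), Literature.Probability.LatticeModels.criticalTwoPoint 3 u * Literature.Probability.LatticeModels.criticalTwoPoint 3 (Pi.single 0 (2 ^ (K + 1)) - u) / Literature.Probability.LatticeModels.criticalTwoPoint 3 (Pi.single 0 (2 ^ (K + 1))))) := by
  sorry

/-- **STUB 2 · `stub_farSourceSandwich` (S–M, provable now) — the Messager–Miracle-Solé sandwich of the
far-source weights.**  With `S_K = Σ_{u ∈ W_K} G(u)`, `T_K` as above, `x_K = ⌊2^K/3⌋ e₁`, `z_K = 9·2^K e₁`: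
`T_K · G(z_K) ≤ S_K · G(x_K)` and `S_K · G(z_K) ≤ T_K · G(x_K)`.  Proof route: for `u ∈ W_K`,
`3‖x_K‖_∞ ≤ 2^K < ‖y_K − u‖_∞ ≤ 3·2^K`, `‖z_K‖_∞ = 9·2^K`, `‖y_K‖_∞ = 2^(K+1)`, so
`twoPointPlus_le_of_mul_supNorm_le (criticalBeta_nonneg 3)` (`d = 3`) gives
`G(z_K) ≤ G(y_K − u) ≤ G(x_K)` and `G(z_K) ≤ G(y_K) ≤ G(x_K)`; multiply out term by term
(`Site.supNorm_single`, `criticalTwoPoint_bounds_holds` for positivity).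
[MessagerMiracleSoleJSP1977; AizenmanDuminilCopinAnnals2021 eq. (5.3)] -/
theorem stub_farSourceSandwich :
    ∀ K : ℕ, (∑ u ∈ (Literature.Probability.LatticeModels.box 3 (2 ^ K)).filter (fun u : Literature.Probability.LatticeModels.Site 3 => ∀ i, u i < 2 ^ K), Literature.Probability.LatticeModels.criticalTwoPoint 3 u * Literature.Probability.LatticeModels.criticalTwoPoint 3 (Pi.single 0 (2 ^ (K + 1)) - u) / Literature.Probability.LatticeModels.criticalTwoPoint 3 (Pi.single 0 (2 ^ (K + 1)))) * Literature.Probability.LatticeModels.criticalTwoPoint 3 (Pi.single 0 ((9 * 2 ^ K : ℕ) : ℤ)) ≤ (∑ u ∈ (Literature.Probability.LatticeModels.box 3 (2 ^ K)).filter (fun u : Literature.Probability.LatticeModels.Site 3 => ∀ i, u i < 2 ^ K), Literature.Probability.LatticeModels.criticalTwoPoint 3 u) * Literature.Probability.LatticeModels.criticalTwoPoint 3 (Pi.single 0 ((2 ^ K / 3 : ℕ) : ℤ)) ∧ (∑ u ∈ (Literature.Probability.LatticeModels.box 3 (2 ^ K)).filter (fun u : Literature.Probability.LatticeModels.Site 3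 => ∀ i, u i < 2 ^ K), Literature.Probability.LatticeModels.criticalTwoPoint 3 u) * Literature.Probability.LatticeModels.criticalTwoPoint 3 (Pi.single 0 ((9 * 2 ^ K : ℕ) : ℤ)) ≤ (∑ u ∈ (Literature.Probability.LatticeModels.box 3 (2 ^ K)).filter (fun u : Literature.Probability.LatticeModels.Site 3 => ∀ i, u i < 2 ^ K), Literature.Probability.LatticeModels.criticalTwoPoint 3 u * Literature.Probability.LatticeModels.criticalTwoPoint 3 (Pi.single 0 (2 ^ (K + 1)) - u) / Literature.Probability.LatticeModels.criticalTwoPoint 3 (Pi.single 0 (2 ^ (K + 1)))) * Literature.Probability.LatticeModels.criticalTwoPoint 3 (Pi.single 0 ((2 ^ K / 3 : ℕ) : ℤ)) := by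
  sorry

/-- **STUB 3 · `stub_temperedDoubling` (L, OPEN — load-bearing) — tempered doubling of the critical two-point
function across a fixed-ratio axis window at dyadic scales.**
`(log₂ G(⌊2^K/3⌋ e₁) − log₂ G(9·2^K e₁)) / K → 0`.  Necessary for the route's conclusion (if
`HasIsingExponentEta 3 η` then both logs are `−(1+η)K + o(K)`); implied by uniform axis doubling
(`MirrorHoelderCompactness.TwoPointDoubling`, item 6150) and axis monotonicity.  Why it might fail: see the
module docstring (completely monotone staircases pass every in-tree two-point constraint; regularity is in
print only at a positive density of scales, ADC21 Thm 5.12; DCP25 Thms 1.2–1.5).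
[AizenmanDuminilCopinAnnals2021 §5; arXiv:2404.05700; DuminilCopinICM2022 §8] -/
theorem stub_temperedDoubling :
    Filter.Tendsto (fun K : ℕ => (Real.logb 2 (Literature.Probability.LatticeModels.criticalTwoPoint 3 (Pi.single 0 ((2 ^ K / 3 : ℕ) : ℤ))) - Real.logb 2 (Literature.Probability.LatticeModels.criticalTwoPoint 3 (Pi.single 0 ((9 * 2 ^ K : ℕ) : ℤ)))) / (K : ℝ)) Filter.atTop (nhds 0) := by
  sorry

/-! ## Names for the statements (hypotheses of the composition)

The layer-invariant audit admits, as hypotheses of the theorem that concludes the crux, only registered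
obligations or the declared stubs BY NAME; `Statement.stub_x` is the statement of `stub_x` (its `type_of%`). -/

namespace Statement

/-- Statement of `stub_firstMomentLimit`. -/
abbrev stub_firstMomentLimit : Prop := type_of% Birth.stub_firstMomentLimit
/-- Statement of `stub_farSourceSandwich`. -/
abbrev stub_farSourceSandwich : Prop := type_of% Birth.stub_farSourceSandwich
/-- Statement of `stub_temperedDoubling`. -/
abbrev stub_temperedDoubling : Prop := type_of% Birth.stub_temperedDoubling

end Statement

/-! ## Local names for the objects (verbatim sub-terms of the route decl), certified by `Iff.rfl` -/

/-- `E_{K,L}[mass_K]`: the integrand/measure of the route decl, verbatim. -/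
def firstMoment (K L : ℕ) : ℝ :=
  ∫ p, ((Finset.univ.filter fun u : ↥(box 3 (L + 1)) => (∀ i, -(2 ^ K : ℤ) ≤ (u : Site 3) i ∧ (u : Site 3) i < 2 ^ K) ∧ p ∈ tracedConn ((SimpleGraph.mk (fun a b : ↥(box 3 (L + 1)) => (zdGraph 3).Adj a.1 b.1 ∧ (a : Site 3) ∈ box 3 L ∧ (b : Site 3) ∈ box 3 L) ⟨fun _ _ h => ⟨h.1.symm, h.2.2, h.2.1⟩⟩ ⟨fun _ h => h.1.ne rfl⟩)) ⟨0, zero_mem_box 3 (L + 1)⟩ u).card : ℝ) ∂(doubleCurrentMeasure ((SimpleGraph.mk (fun a b : ↥(box 3 (L + 1)) => (zdGraph 3).Adj a.1 b.1 ∧ (a : Site 3) ∈ box 3 L ∧ (b : Site 3) ∈ box 3 L) ⟨fun _ _ h => ⟨h.1.symm, h.2.2, h.2.1⟩⟩ ⟨fun _ h => h.1.ne rfl⟩)) (criticalBeta 3) (Finset.univ.filter fun v : ↥(box 3 (L + 1)) => (v : Site 3) = 0 ∨ (v : Site 3) = Pi.single 0 (2 ^ (K + 1))) ∅)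

/-- `S_K = Σ_{u ∈ W_K} G(u)`, verbatim. -/
def windowSum (K : ℕ) : ℝ :=
  ∑ u ∈ (box 3 (2 ^ K)).filter (fun u : Site 3 => ∀ i, u i < 2 ^ K), criticalTwoPoint 3 u

/-- `T_K = Σ_{u ∈ W_K} G(u) G(y_K − u) / G(y_K)`. -/
def switchedSum (K : ℕ) : ℝ :=
  ∑ u ∈ (box 3 (2 ^ K)).filter (fun u : Site 3 => ∀ i, u i < 2 ^ K), criticalTwoPoint 3 u * criticalTwoPoint 3 (Pi.single 0 (2 ^ (K + 1)) - u) / criticalTwoPoint 3 (Pi.single 0 (2 ^ (K + 1)))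

/-- `G(x_K)`, `x_K = ⌊2^K/3⌋ e₁`. -/
def nearVal (K : ℕ) : ℝ :=
  criticalTwoPoint 3 (Pi.single 0 ((2 ^ K / 3 : ℕ) : ℤ))

/-- `G(z_K)`, `z_K = 9·2^K e₁`. -/
def farVal (K : ℕ) : ℝ :=
  criticalTwoPoint 3 (Pi.single 0 ((9 * 2 ^ K : ℕ) : ℤ))

/-- The crux, read through the local names (definitional). -/
theorem crux_iff :
    Summit.CriticalPhenomena.Ising3DConformalLimit.Theses.OctantEntropy.FirstMomentBoxSum ↔
      Tendsto (fun K : ℕ => (limsup (fun L : ℕ => Real.logb 2 (firstMoment K L)) atTop -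
        Real.logb 2 (windowSum K)) / (K : ℝ)) atTop (𝓝 0) :=
  Iff.rfl

/-- Stub 1, read through the local names (definitional). -/
theorem stub_firstMomentLimit_iff :
    Statement.stub_firstMomentLimit ↔
      ∀ K : ℕ, Tendsto (fun L : ℕ => firstMoment K L) atTop (𝓝 (switchedSum K)) :=
  Iff.rfl

/-- Stub 2, read through the local names (definitional). -/
theorem stub_farSourceSandwich_iff :
    Statement.stub_farSourceSandwich ↔
      ∀ K : ℕ, switchedSum K * farVal K ≤ windowSum K * nearVal K ∧
        windowSum K * farVal K ≤ switchedSum K * nearVal K :=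
  Iff.rfl

/-- Stub 3, read through the local names (definitional). -/
theorem stub_temperedDoubling_iff :
    Statement.stub_temperedDoubling ↔
      Tendsto (fun K : ℕ => (Real.logb 2 (nearVal K) - Real.logb 2 (farVal K)) / (K : ℝ)) atTop (𝓝 0) :=
  Iff.rfl

/-! ## Elementary facts used by the composition (proved) -/

/-- `0 < ⟨σ₀σ_u⟩_{β_c(3)}` (Simon–Lieb lower bound off the origin, `= 1` at the origin). [folklore] -/
theorem criticalTwoPoint_pos (u : Site 3) : 0 < criticalTwoPoint 3 u := by
  by_cases hu : u = 0
  · rw [hu]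
    show 0 < twoPointPlus 3 (criticalBeta 3) 0
    rw [twoPointPlus_zero]
    exact one_pos
  · obtain ⟨c, C, hc, h⟩ := criticalTwoPoint_bounds_holds (d := 3) le_rfl
    have hn : 0 < ‖u‖ := norm_pos_iff.2 hu
    exact lt_of_lt_of_le (mul_pos hc (Real.rpow_pos_of_pos hn _)) (h u hu).1

/-- `S_K > 0` (the window contains the origin, all terms are positive). [folklore] -/
theorem windowSum_pos (K : ℕ) : 0 < windowSum K := by
  unfold windowSum
  have h0 : (0 : Site 3) ∈ (box 3 (2 ^ K)).filter (fun u : Site 3 => ∀ i, u i < 2 ^ K) := by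
    rw [Finset.mem_filter]
    exact ⟨zero_mem_box 3 _, fun i => by simp⟩
  exact lt_of_lt_of_le (criticalTwoPoint_pos 0)
    (Finset.single_le_sum (fun u _ => (criticalTwoPoint_pos u).le) h0)

/-- `G(x_K) > 0`. [folklore] -/
theorem nearVal_pos (K : ℕ) : 0 < nearVal K := criticalTwoPoint_pos _

/-- `G(z_K) > 0`. [folklore] -/
theorem farVal_pos (K : ℕ) : 0 < farVal K := criticalTwoPoint_pos _

/-! ## The composition: the three stubs imply the crux, by name (real proof, no `sorry`) -/

/-- **`FirstMomentBoxSum` from the stubs.**  `T_K > 0` (sandwich + `S_K, G > 0`); `b_K = log₂ T_K`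
(`stub_firstMomentLimit`, continuity of `log` at `T_K ≠ 0`, `Tendsto.limsup_eq`);
`|log₂ T_K − log₂ S_K| ≤ log₂ G(x_K) − log₂ G(z_K)` (`stub_farSourceSandwich`, monotonicity of `log₂`);
squeeze with `stub_temperedDoubling` (at `K = 0` both sides are the junk `x / 0 = 0`). -/
theorem FirstMomentBoxSum_of (h₁ : Statement.stub_firstMomentLimit)
    (h₂ : Statement.stub_farSourceSandwich) (h₃ : Statement.stub_temperedDoubling) :
    Summit.CriticalPhenomena.Ising3DConformalLimit.Theses.OctantEntropy.FirstMomentBoxSum := by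
  rw [stub_firstMomentLimit_iff] at h₁
  rw [stub_farSourceSandwich_iff] at h₂
  rw [stub_temperedDoubling_iff] at h₃
  rw [crux_iff]
  -- positivity of the switched sum, from the lower sandwich inequality
  have hT : ∀ K, 0 < switchedSum K := fun K =>
    (mul_pos_iff_of_pos_right (nearVal_pos K)).1
      (lt_of_lt_of_le (mul_pos (windowSum_pos K) (farVal_pos K)) (h₂ K).2)
  -- the thermodynamic limit in log form: b_K = log₂ T_K
  have hb : ∀ K, limsup (fun L : ℕ => Real.logb 2 (firstMoment K L)) atTop =
      Real.logb 2 (switchedSum K) := fun K =>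
    Tendsto.limsup_eq (((h₁ K).log (hT K).ne').div_const (Real.log 2))
  -- two-sided bound from the sandwich
  have hbound : ∀ K, |Real.logb 2 (switchedSum K) - Real.logb 2 (windowSum K)| ≤
      Real.logb 2 (nearVal K) - Real.logb 2 (farVal K) := fun K => by
    have hS := windowSum_pos K
    have hn := nearVal_pos K
    have hf := farVal_pos K
    have h1 := Real.logb_le_logb_of_le one_lt_two (mul_pos (hT K) hf) (h₂ K).1
    have h2 := Real.logb_le_logb_of_le one_lt_two (mul_pos hS hf) (h₂ K).2
    rw [Real.logb_mul (hT K).ne' hf.ne', Real.logb_mul hS.ne' hn.ne'] at h1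
    rw [Real.logb_mul hS.ne' hf.ne', Real.logb_mul (hT K).ne' hn.ne'] at h2
    rw [abs_le]
    constructor <;> linarith
  -- squeeze
  have hK : ∀ K : ℕ, ‖(limsup (fun L : ℕ => Real.logb 2 (firstMoment K L)) atTop -
      Real.logb 2 (windowSum K)) / (K : ℝ)‖ ≤
        (Real.logb 2 (nearVal K) - Real.logb 2 (farVal K)) / (K : ℝ) := fun K => by
    rw [hb K, Real.norm_eq_abs, abs_div, Nat.abs_cast]
    exact div_le_div_of_nonneg_right (hbound K) (Nat.cast_nonneg K)
  exact squeeze_zero_norm hK h₃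

end Summit.CriticalPhenomena.Ising3DConformalLimit.Cruxes.FirstMomentBoxSum.Birth

end
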